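import Summits.BirchSwinnertonDyer.Rank1Residual.Additive.CyclotomicTowerSignedSelmer
import Literature.NumberTheory.EllipticCurves.IwasawaNakayamaProofs
import HarnessLib

/-!
# The dual `X^ε(E/K_∞)^η` EXISTS as a `Λ = ℤ_p[[Γ]]`-module (`T = γ − 1`): `p`-primarity, local
# nilpotence of `conj_γ − 1` on `H¹(K₀·K_∞^κ, E[p^∞])`, and the datum
# (cell `b2b-bsdres`, CLASS-CLOSURE lane, seat cc-typer-6 GEN 8; the (B′) OBJECT of
# `cells/n1011/skel/T-O7ss-P13-DISCHARGE-SCOPING.md` §1 — FILE 3 of 3; sequel of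
# `CyclotomicTowerSignedSelmer.lean` (FILE 2, the structure), word for word p17's
# `StrictSignedSelmerDual.lean` §1–§2 and the tree's `IwasawaSelmerDualProofs` (P)/(A1)/(A2) with
# `ker κ ↦ towerTopSubgroup κ K₀ = ker κ ⊓ Gal(K̄/K₀)`)

HONEST FRAMING (cell `b2b-bsdres`, run/shared/lean/b2b/bsd-rank1-residual/, verbatim in every
file): the goal of the cell is to DELETE the COMBINATION-SHAPED residual classes of the
Birch–Swinnerton-Dyer formula for ALL analytic-rank `≤ 1` elliptic curves over `ℚ` — "full BSD
formula for every rank `≤ 1` curve in class `C`" assembled STRICTLY from published theorems — so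
that the rank-`≤ 1` remainder becomes exactly the CONSTRUCTION-SHAPED classes, which are TYPED
(missing-input `Prop`s), NOT attempted. This is not "finishing BSD". CLASS-CLOSURE lane: prove
what is provable now; shrink each hard class to its core with data; no claim beyond stated classes;
research routes; census output = EVIDENCE / conjecture items, never a Literature fact;
RESIDUAL-MAP marks change only by signed lines. O7-ss stays OPEN, X4 CONSTRUCTION-SHAPED; nothing
here is booked; no label moves. ONE definition (`conjTowerSignedSelmerInftyEta`, the restricted
conjugation) and ONE construction (`etaSignedSelmerDualData`, the dual as a datum); theorems
otherwise; no named Literature fact; no `sorry`; `#print axioms` standard.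

## Contents

* §1 `Gal(K̄/K₀·K_∞^κ)` is compact; (P) every class of `H¹(K₀·K_∞, E[p^∞])` is killed by a power
  of `p`; (A1) every class is fixed by `conj_τ` for `τ` in an open normal subgroup of `Γ_K`; (A2) for
  `γ ∈ Gal(K̄/K₀)` with `κ γ` a generator every class is fixed by some `conj_{γ^{p^a}}` — under the
  hypothesis that `κ` is onto on `Gal(K̄/K₀)` (`K₀ ∩ K_∞^κ = K`; §4: automatic when `p ∤ [K₀ : K]`),
  which is what makes `Γ = Gal(K₀K_∞/K₀) ≅ ℤ_p` with generator `γ` ("`G_∞ = Δ × Γ`", p. 5).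
* §2 `conjTowerSignedSelmerInftyEta` — `conj_γ` as an endomorphism of `Sel^ε(E/K_∞)^η`; powers;
  `IwasawaDual.IsLocNil p (conj_γ − 1)` under the hypotheses of (A2).
* §3 EXISTENCE: `etaSignedSelmerDualData … : EtaSignedSelmerDualData W κ K₀ E η γ ε` —
  `X = Hom(Sel^{ε,η}_∞, ℚ/ℤ)` with the `Λ`-structure `IsLocNil.module`; so every statement
  "`∀ D : EtaSignedSelmerDualData …`" (the future verbatim facts Thm. 2.2 + 4.1 third display /
  Thm. 7.4 / KO18 Thm. 1.3 on this object — NOT here) is NON-VACUOUS under (A2)'s hypotheses.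
* §4 THE TAME CASE: for `K₀/K` Galois with `p ∤ [K₀ : K]` (Kobayashi's `ℚ(μ_p)/ℚ`, degree `p − 1`)
  the hypothesis of (A2) HOLDS (`kappa_surjOn_galRange_of_coprime_finrank`), a topological generator
  inside `Gal(K̄/K₀)` exists, and the datum exists for every such `γ`.
* §5 KOBAYASHI'S SETTING VERBATIM: `K = ℚ`, `K₀ = ℚ(μ_p)` (any `IsCyclotomicExtension {p} ℚ K₀`):
  `[K₀ : ℚ] = p − 1` ⇒ §4 applies (`kappa_surjOn_galRange_cyclotomic`,
  `nonempty_etaSignedSelmerDualData_cyclotomic`).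

References: [Kobayashi2003] §2 p. 4, Def. 2.1, §3 p. 5–6, §4 p. 8; [GreenbergLNM1716] §1 (p. 60);
[SerreGaloisCohomology1997] I.§2.6 (b); [SerreLocalFields1979] VII.§5 Prop. 3.
-/

noncomputable section

open scoped Classical

universe u

namespace Summit.BirchSwinnertonDyer.Rank1Residual.Additive

open WeierstrassCurve Literature.NumberTheory.EllipticCurves Literature.NumberTheory.GaloisRepresentations
  Literature.NumberTheory.EllipticCurves.IwasawaAlgebra Literature.NumberTheory.EllipticCurves.IwasawaDual
  Literature.NumberTheory.EllipticCurves.Kobayashi2003 ZpExtension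

variable {K : Type u} [Field K] [NumberField K] (W : WeierstrassCurve K) {p : ℕ} [Fact p.Prime]
  (κ : ZpExtension K p) (K₀ : Type u) [Field K₀] [NumberField K₀] [Algebra K K₀]
  (E : Type u) [Field E] [Algebra K E]

/-! ## §1 Compactness, `p`-primarity (P), continuity (A1), local finiteness of `γ` (A2) -/

omit [NumberField K] in
/-- `Gal(K̄/K₀) = galRange K₀` is closed in `Γ_K`: it is the image of the compact `Γ_{K₀}` under the
continuous restriction `resGal K₀`. Serre, *Galois Cohomology*, II.§1.1. [folklore] -/
theorem isClosed_galRange : IsClosed (galRange (K := K) K₀ : Set (Field.absoluteGaloisGroup K)) := by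
  have h : (galRange (K := K) K₀ : Set (Field.absoluteGaloisGroup K)) =
      Set.range (Literature.NumberTheory.EllipticCurves.resGal (K := K) K₀) := by
    ext g
    rw [SetLike.mem_coe, mem_galRange_iff, Set.mem_range]
  rw [h]
  exact (isCompact_range
    (map_continuous (Literature.NumberTheory.EllipticCurves.resGal (K := K) K₀))).isClosed

/-- `Gal(K̄/K₀·K_∞^κ) = ker κ ⊓ Gal(K̄/K₀)` is compact (closed in the profinite `Γ_K`).
[folklore] -/
instance compactSpace_towerTopSubgroup : CompactSpace (towerTopSubgroup κ K₀) :=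
  isCompact_iff_compactSpace.mp (IsClosed.isCompact (by
    rw [towerTopSubgroup, Subgroup.coe_inf]
    exact κ.isClosed_kerSubgroup.inter (isClosed_galRange K₀)))

/-- **(P)** Every class of `H¹(K₀·K_∞, E[p^∞])` is killed by a power of `p` (compact group, discrete
`p`-primary coefficients: `IwasawaDual.exists_pow_smul_oneCocycleClass_eq_zero`) — word for word the
tree's `exists_pow_smul_subgroupH1_ker_eq_zero`. [cite: GreenbergLNM1716, §1 (after Conj. 1.3)] -/
theorem exists_pow_smul_subgroupH1_towerTop_eq_zero (c : W.subgroupH1 p (towerTopSubgroup κ K₀)) :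
    ∃ k : ℕ, p ^ k • c = 0 := by
  obtain ⟨φ, rfl⟩ := oneCocycleClass_surjective _ c
  exact IwasawaDual.exists_pow_smul_oneCocycleClass_eq_zero φ fun σ ↦ by
    obtain ⟨k, hk⟩ := (φ.1 σ).2
    exact ⟨k, Subtype.ext (by rw [AddSubgroupClass.coe_nsmul]; exact hk)⟩

variable [(galRange (K := K) K₀).Normal]

/-- **(A1)** Every class of `H¹(K₀·K_∞, E[p^∞])` is fixed by `conj_τ` for all `τ` in some open
normal subgroup of `Γ_K`: the cocycle has finitely many values (each with open stabiliser) and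
vanishes near `1`; take an open normal subgroup inside both open sets and apply the cocycle-level
criterion `IwasawaDual.conjH1_oneCocycleClass_eq` — word for word the tree's
`exists_openNormalSubgroup_conjH1_eq` with `ker κ ↦ towerTopSubgroup κ K₀`.
[cite: GreenbergLNM1716, §1 (after Conj. 1.3)] -/
theorem exists_openNormalSubgroup_conjH1_towerTop_eq (c : W.subgroupH1 p (towerTopSubgroup κ K₀)) :
    ∃ Nrm : OpenNormalSubgroup (Field.absoluteGaloisGroup K),
      ∀ τ ∈ Nrm, W.conjH1 p (towerTopSubgroup κ K₀) τ c = c := by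
  obtain ⟨φ, rfl⟩ := oneCocycleClass_surjective _ c
  have hfin : (Set.range φ.1).Finite := (isCompact_range φ.1.continuous).finite_of_discrete
  set Ufix : Set (Field.absoluteGaloisGroup K) :=
    {τ | ∀ m ∈ Set.range φ.1, τ • m = m} with hUfix_def
  have hUfix : IsOpen Ufix := by
    have e : Ufix = ⋂ m ∈ Set.range φ.1,
        (MulAction.stabilizer (Field.absoluteGaloisGroup K) m : Set (Field.absoluteGaloisGroup K)) := by
      ext τ
      simp only [hUfix_def, Set.mem_setOf_eq, Set.mem_iInter, SetLike.mem_coe,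
        MulAction.mem_stabilizer_iff]
    rw [e]
    refine hfin.isOpen_biInter fun m _ ↦ ?_
    have hm : (MulAction.stabilizer (Field.absoluteGaloisGroup K) m : Set (Field.absoluteGaloisGroup K)) =
        MulAction.stabilizer (Field.absoluteGaloisGroup K) (m : geomPoints W) := by
      ext τ
      simp only [SetLike.mem_coe, MulAction.mem_stabilizer_iff, Subtype.ext_iff,
        primaryComponent.coe_smul]
    rw [hm]
    exact isOpen_stabilizer_point_holds W (m : geomPoints W)
  have hz : IsOpen {h : towerTopSubgroup κ K₀ | φ.1 h = 0} :=
    (isOpen_discrete ({0} : Set (geomPrimaryTorsion W p))).preimage φ.1.continuous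
  obtain ⟨U0, hU0, hU0eq⟩ := isOpen_induced_iff.mp hz
  have h1fix : (1 : Field.absoluteGaloisGroup K) ∈ Ufix := fun m _ ↦ one_smul _ m
  have h1U0 : (1 : Field.absoluteGaloisGroup K) ∈ U0 := by
    have : (1 : towerTopSubgroup κ K₀) ∈ Subtype.val ⁻¹' U0 := by
      rw [hU0eq]
      exact contOneCocycles.apply_one φ
    exact this
  obtain ⟨Nrm, hNrm⟩ := ProfiniteGrp.exist_openNormalSubgroup_sub_open_nhds_of_one
    (hUfix.inter hU0) ⟨h1fix, h1U0⟩
  refine ⟨Nrm, fun τ hτ ↦ IwasawaDual.conjH1_oneCocycleClass_eq φ (fun h ↦ ?_) (fun h n hn ↦ ?_)⟩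
  · exact (hNrm hτ).1 _ ⟨h, rfl⟩
  · have hnN : (n : Field.absoluteGaloisGroup K) ∈ Nrm := by
      rw [hn]
      have h1 : (h : Field.absoluteGaloisGroup K)⁻¹ * τ⁻¹ * (h : Field.absoluteGaloisGroup K)⁻¹⁻¹ ∈
          Nrm.toSubgroup :=
        Subgroup.Normal.conj_mem inferInstance _ (Nrm.toSubgroup.inv_mem hτ) _
      rw [inv_inv] at h1
      exact Nrm.toSubgroup.mul_mem h1 hτ
    have hn0 : n ∈ Subtype.val ⁻¹' U0 := (hNrm hnN).2
    rw [hU0eq] at hn0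
    exact hn0

/-- **(A2)** Let `γ ∈ Gal(K̄/K₀)` with `κ γ = 1` (a topological generator of `Γ = Gal(K₀K_∞/K₀)`), and
assume `κ` maps `Gal(K̄/K₀)` ONTO `ℤ_p` (`K₀ ∩ K_∞^κ = K`). Then every class of `H¹(K₀·K_∞, E[p^∞])`
is fixed by `conj_{γ^{p^a}}` for some `a`: with `Nrm` as in (A1) of index `d = p^a e`, `p ∤ e`, and
`g₀ ∈ Gal(K̄/K₀)` with `κ g₀ = e⁻¹`, the element `τ = g₀^d ∈ Nrm` has `κ τ = p^a = κ(γ^{p^a})` and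
lies in `Gal(K̄/K₀)`, so `τ⁻¹γ^{p^a} ∈ ker κ ⊓ Gal(K̄/K₀)` acts trivially (`conjH1_of_mem_holds`) — the
tree's `exists_conjH1_pow_prime_pow_eq`, run inside `Gal(K̄/K₀)`.
[cite: GreenbergLNM1716, §1 (after Conj. 1.3)] [cite: Kobayashi2003, §3 p. 5 (Γ ≅ ℤ_p, γ ∈ Γ)] -/
theorem exists_conjH1_pow_prime_pow_towerTop_eq
    (hK₀ : ∀ x : Multiplicative ℤ_[p], ∃ g ∈ galRange (K := K) K₀, κ g = x)
    {γ : Field.absoluteGaloisGroup K} (hγ : κ.IsTopGenerator γ) (hγ₀ : γ ∈ galRange (K := K) K₀)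
    (c : W.subgroupH1 p (towerTopSubgroup κ K₀)) :
    ∃ a : ℕ, W.conjH1 p (towerTopSubgroup κ K₀) (γ ^ p ^ a) c = c := by
  obtain ⟨Nrm, hNrm⟩ := exists_openNormalSubgroup_conjH1_towerTop_eq W κ K₀ c
  haveI : Finite (Field.absoluteGaloisGroup K ⧸ Nrm.toSubgroup) :=
    Subgroup.quotient_finite_of_isOpen _ Nrm.isOpen
  have hd : Nrm.toSubgroup.index ≠ 0 := Subgroup.index_ne_zero_of_finite
  obtain ⟨a, e, he, hde⟩ := Nat.exists_eq_pow_mul_and_not_dvd hd p (Fact.out : p.Prime).ne_one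
  obtain ⟨u, hu⟩ := IwasawaDual.isUnit_natCast_padicInt (p := p) he
  obtain ⟨g₀, hg₀K, hg₀⟩ := hK₀ (Multiplicative.ofAdd ((u⁻¹ : ℤ_[p]ˣ) : ℤ_[p]))
  have hτN : g₀ ^ Nrm.toSubgroup.index ∈ Nrm := Nrm.toSubgroup.pow_index_mem g₀
  have hκτ : (κ (g₀ ^ Nrm.toSubgroup.index)).toAdd = (p : ℤ_[p]) ^ a := by
    rw [map_pow, hg₀, ← ofAdd_nsmul, toAdd_ofAdd, nsmul_eq_mul, hde, Nat.cast_mul, Nat.cast_pow,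
      ← hu, mul_assoc, Units.mul_inv, mul_one]
  have hκγ : (κ (γ ^ p ^ a)).toAdd = (p : ℤ_[p]) ^ a := by
    rw [map_pow, show κ γ = Multiplicative.ofAdd 1 from hγ, ← ofAdd_nsmul, toAdd_ofAdd, nsmul_eq_mul,
      mul_one, Nat.cast_pow]
  have hh₀ : (g₀ ^ Nrm.toSubgroup.index)⁻¹ * γ ^ p ^ a ∈ towerTopSubgroup κ K₀ := by
    refine (mem_towerTopSubgroup_iff κ K₀ _).mpr ⟨?_, ?_⟩
    · rw [ZpExtension.mem_kerSubgroup, map_mul, map_inv]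
      apply Multiplicative.toAdd.injective
      rw [toAdd_mul, toAdd_inv, hκτ, hκγ, toAdd_one, neg_add_cancel]
    · exact Subgroup.mul_mem _ (Subgroup.inv_mem _ (Subgroup.pow_mem _ hg₀K _))
        (Subgroup.pow_mem _ hγ₀ _)
  refine ⟨a, ?_⟩
  conv_lhs => rw [← mul_inv_cancel_left (g₀ ^ Nrm.toSubgroup.index) (γ ^ p ^ a)]
  rw [W.conjH1_mul_holds p (towerTopSubgroup κ K₀), AddMonoidHom.comp_apply,
    W.conjH1_of_mem_holds p (towerTopSubgroup κ K₀) hh₀, AddMonoidHom.id_apply]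
  exact hNrm _ hτN

omit [NumberField K] [NumberField K₀] [(galRange (K := K) K₀).Normal] in
/-- The surjectivity hypothesis of (A2) from the Galois-theoretic condition
`Gal(K̄/K₀) ⊔ ker κ = Γ_K` (i.e. `K₀ ∩ K_∞^κ = K`): every `g = h·k` with `h ∈ Gal(K̄/K₀)`,
`k ∈ ker κ`, so `κ h = κ g`. [folklore] -/
theorem kappa_surjOn_galRange_of_sup_eq_top (hsup : galRange (K := K) K₀ ⊔ κ.kerSubgroup = ⊤)
    (x : Multiplicative ℤ_[p]) : ∃ g ∈ galRange (K := K) K₀, κ g = x := by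
  obtain ⟨g, rfl⟩ := κ.surjective x
  have hg : g ∈ galRange (K := K) K₀ ⊔ κ.kerSubgroup := by rw [hsup]; exact Subgroup.mem_top g
  rw [Subgroup.mem_sup_of_normal_right] at hg
  obtain ⟨h, hh, k, hk, rfl⟩ := hg
  refine ⟨h, hh, ?_⟩
  change κ h = κ (h * k)
  rw [map_mul, ZpExtension.mem_kerSubgroup.mp hk, mul_one]

/-! ## §2 The conjugation endomorphism of `Sel^ε(E/K_∞)^η` and local nilpotence -/

variable (η : Field.absoluteGaloisGroup K →* ℤˣ) (ε : ℤˣ)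

/-- `conj_γ` restricted to an endomorphism of `Sel^ε(E/K_∞)^η` (it preserves the `η`-component by
`conjH1_mem_towerSignedSelmerInftyEta`) — the action through which `Λ = ℤ_p[[Γ]]` acts on
`X^ε(E/K_∞)^η`. [cite: Kobayashi2003, §4 p. 8 (X^±(E/K_∞)^η a ℤ_p[[Γ]]-module)] -/
def conjTowerSignedSelmerInftyEta (γ : Field.absoluteGaloisGroup K) :
    AddMonoid.End (towerSignedSelmerInftyEta W κ K₀ E η ε) :=
  ((W.conjH1 p (towerTopSubgroup κ K₀) γ).restrict (towerSignedSelmerInftyEta W κ K₀ E η ε)).codRestrict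
    (towerSignedSelmerInftyEta W κ K₀ E η ε)
    fun s ↦ conjH1_mem_towerSignedSelmerInftyEta W κ K₀ E η ε γ s.2

/-- Unfolding `conjTowerSignedSelmerInftyEta` (definitional). [cite: Kobayashi2003, §4 p. 8] -/
@[simp]
theorem coe_conjTowerSignedSelmerInftyEta_apply (γ : Field.absoluteGaloisGroup K)
    (s : towerSignedSelmerInftyEta W κ K₀ E η ε) :
    ((conjTowerSignedSelmerInftyEta W κ K₀ E η ε γ s : towerSignedSelmerInftyEta W κ K₀ E η ε) :
        W.subgroupH1 p (towerTopSubgroup κ K₀)) = W.conjH1 p (towerTopSubgroup κ K₀) γ s :=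
  rfl

/-- `conj_γ − 1` acts on underlying classes as `conj_γ s − s`. [cite: Kobayashi2003, §4 p. 8] -/
theorem coe_conjTowerSignedSelmerInftyEta_sub_one_apply (γ : Field.absoluteGaloisGroup K)
    (s : towerSignedSelmerInftyEta W κ K₀ E η ε) :
    (((conjTowerSignedSelmerInftyEta W κ K₀ E η ε γ - 1) s : towerSignedSelmerInftyEta W κ K₀ E η ε) :
        W.subgroupH1 p (towerTopSubgroup κ K₀)) = W.conjH1 p (towerTopSubgroup κ K₀) γ s - s := by
  rw [IwasawaDual.End_sub_apply, AddMonoid.End.one_apply, AddSubgroupClass.coe_sub,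
    coe_conjTowerSignedSelmerInftyEta_apply]

/-- Powers of the restriction are restrictions of `conj_{γ^m}` (`conjH1_one_holds`,
`conjH1_mul_holds`). [cite: Kobayashi2003, §4 p. 8] -/
theorem coe_conjTowerSignedSelmerInftyEta_pow_apply (γ : Field.absoluteGaloisGroup K) (m : ℕ)
    (s : towerSignedSelmerInftyEta W κ K₀ E η ε) :
    ((((conjTowerSignedSelmerInftyEta W κ K₀ E η ε γ) ^ m) s : towerSignedSelmerInftyEta W κ K₀ E η ε) :
        W.subgroupH1 p (towerTopSubgroup κ K₀)) = W.conjH1 p (towerTopSubgroup κ K₀) (γ ^ m) s := by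
  induction m generalizing s with
  | zero => rw [pow_zero, pow_zero, AddMonoid.End.one_apply,
      W.conjH1_one_holds p (towerTopSubgroup κ K₀), AddMonoidHom.id_apply]
  | succ m ih =>
    rw [pow_succ, AddMonoid.End.coe_mul, Function.comp_apply, ih,
      coe_conjTowerSignedSelmerInftyEta_apply, pow_succ, W.conjH1_mul_holds p (towerTopSubgroup κ K₀),
      AddMonoidHom.comp_apply]

/-- **`Sel^ε(E/K_∞)^η` is `p`-primary and `T = conj_γ − 1` is locally nilpotent on it** (the
hypotheses `IwasawaDual.IsLocNil` of the generic `Λ`-action), for `γ ∈ Gal(K̄/K₀)` with `κ γ = 1` and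
`κ` onto on `Gal(K̄/K₀)`: (P) and (A2) above with `IwasawaDual.pow_mul_prime_pow_apply_eq_zero` —
word for word `isLocNil_conjStrictSignedSelmerInfty_sub_one`. [cite: GreenbergLNM1716, §1 (p. 60)] -/
theorem isLocNil_conjTowerSignedSelmerInftyEta_sub_one
    (hK₀ : ∀ x : Multiplicative ℤ_[p], ∃ g ∈ galRange (K := K) K₀, κ g = x)
    {γ : Field.absoluteGaloisGroup K} (hγ : κ.IsTopGenerator γ) (hγ₀ : γ ∈ galRange (K := K) K₀) :
    IwasawaDual.IsLocNil p (conjTowerSignedSelmerInftyEta W κ K₀ E η ε γ - 1) := by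
  have htor : ∀ s : towerSignedSelmerInftyEta W κ K₀ E η ε, ∃ k : ℕ, p ^ k • s = 0 := fun s ↦ by
    obtain ⟨k, hk⟩ := exists_pow_smul_subgroupH1_towerTop_eq_zero W κ K₀
      (s : W.subgroupH1 p (towerTopSubgroup κ K₀))
    exact ⟨k, Subtype.ext (by rw [AddSubgroupClass.coe_nsmul]; exact hk)⟩
  refine ⟨htor, fun s ↦ ?_⟩
  obtain ⟨a, ha⟩ := exists_conjH1_pow_prime_pow_towerTop_eq W κ K₀ hK₀ hγ hγ₀
    (s : W.subgroupH1 p (towerTopSubgroup κ K₀))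
  obtain ⟨k, hk⟩ := htor s
  have hφ : ((conjTowerSignedSelmerInftyEta W κ K₀ E η ε γ) ^ p ^ a) s = s :=
    Subtype.ext (by rw [coe_conjTowerSignedSelmerInftyEta_pow_apply]; exact ha)
  exact ⟨k * p ^ a, IwasawaDual.pow_mul_prime_pow_apply_eq_zero (Fact.out : p.Prime) _ a hφ hk⟩

/-! ## §3 Existence of the dual datum -/

/-- **The Iwasawa module `X^ε(E/K_∞)^η = Hom(Sel^ε(E/K_∞)^η, ℚ/ℤ)` with its `Λ`-module structure**
(`T = γ − 1`, constants through `ℤ_p → ℤ/pᵏ`) packaged as an `EtaSignedSelmerDualData W κ K₀ E η γ ε`: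
`X = (Sel^{ε,η}_∞ →+ AddCircle 1)`, `toDual = id`, module structure `IsLocNil.module` — word for word
the tree's `signedSelmerDualData` / p17's `strictSignedSelmerDualData`.
[cite: GreenbergLNM1716, §1 (p. 60)] [cite: Kobayashi2003, Def. 2.1 (p. 5) and §4 p. 8] -/
def etaSignedSelmerDualData
    (hK₀ : ∀ x : Multiplicative ℤ_[p], ∃ g ∈ galRange (K := K) K₀, κ g = x)
    {γ : Field.absoluteGaloisGroup K} (hγ : κ.IsTopGenerator γ) (hγ₀ : γ ∈ galRange (K := K) K₀) :
    EtaSignedSelmerDualData W κ K₀ E η γ ε :=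
  { X := towerSignedSelmerInftyEta W κ K₀ E η ε →+ AddCircle (1 : ℚ)
    module := (isLocNil_conjTowerSignedSelmerInftyEta_sub_one W κ K₀ E η ε hK₀ hγ hγ₀).module
    conj_mem := fun s hs ↦ conjH1_mem_towerSignedSelmerInftyEta W κ K₀ E η ε γ hs
    toDual := AddMonoidHom.id _
    bijective := Function.bijective_id
    toDual_T_smul := fun x s ↦ by
      show (isLocNil_conjTowerSignedSelmerInftyEta_sub_one W κ K₀ E η ε hK₀ hγ hγ₀).smulFun
          PowerSeries.X x s = x _ - x s
      rw [(isLocNil_conjTowerSignedSelmerInftyEta_sub_one W κ K₀ E η ε hK₀ hγ hγ₀).smulFun_X_apply,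
        IwasawaDual.End_sub_apply, AddMonoid.End.one_apply, map_sub]
      rfl
    toDual_C_smul := fun c x s k hk ↦ by
      show (isLocNil_conjTowerSignedSelmerInftyEta_sub_one W κ K₀ E η ε hK₀ hγ hγ₀).smulFun
          (PowerSeries.C c) x s = _
      exact (isLocNil_conjTowerSignedSelmerInftyEta_sub_one W κ K₀ E η ε hK₀ hγ hγ₀).smulFun_C_apply
        c x hk }

/-- **Existence**: for `γ ∈ Gal(K̄/K₀)` with `κ γ = 1` and `κ` onto on `Gal(K̄/K₀)`, the Pontryagin
dual of `Sel^ε(E/K_∞)^η` carries a `Λ`-module structure with `T = γ − 1`, i.e.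
`EtaSignedSelmerDualData W κ K₀ E η γ ε` is inhabited — NON-VACUITY of every statement
"`∀ D : EtaSignedSelmerDualData …`". [cite: GreenbergLNM1716, §1 (p. 60)] -/
theorem nonempty_etaSignedSelmerDualData
    (hK₀ : ∀ x : Multiplicative ℤ_[p], ∃ g ∈ galRange (K := K) K₀, κ g = x)
    {γ : Field.absoluteGaloisGroup K} (hγ : κ.IsTopGenerator γ) (hγ₀ : γ ∈ galRange (K := K) K₀) :
    Nonempty (EtaSignedSelmerDualData W κ K₀ E η γ ε) :=
  ⟨etaSignedSelmerDualData W κ K₀ E η ε hK₀ hγ hγ₀⟩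

/-- Every datum `D : EtaSignedSelmerDualData W κ K₀ E η γ ε` is a dual pair for `ψ = conj_γ − 1` on
`Sel^ε(E/K_∞)^η` (`toDual_T_smul`, `toDual_C_smul`, local nilpotence under (A2)'s hypotheses) — the
interface of the tree's generic `Λ`-module bookkeeping (`IwasawaDual.IsDualPair`: characteristic
ideal vs. invariants / bottom layers). [cite: GreenbergLNM1716, §1 (p. 60)] -/
theorem EtaSignedSelmerDualData.isDualPair {γ : Field.absoluteGaloisGroup K}
    (D : EtaSignedSelmerDualData W κ K₀ E η γ ε)
    (hK₀ : ∀ x : Multiplicative ℤ_[p], ∃ g ∈ galRange (K := K) K₀, κ g = x)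
    (hγ : κ.IsTopGenerator γ) (hγ₀ : γ ∈ galRange (K := K) K₀) :
    IwasawaDual.IsDualPair p (conjTowerSignedSelmerInftyEta W κ K₀ E η ε γ - 1) D.toDual where
  bijective := D.bijective
  T_smul x s := by
    rw [D.toDual_T_smul, IwasawaDual.End_sub_apply, AddMonoid.End.one_apply, map_sub]
    rfl
  C_smul c x s k hk := D.toDual_C_smul c x s k hk
  locNil := isLocNil_conjTowerSignedSelmerInftyEta_sub_one W κ K₀ E η ε hK₀ hγ hγ₀

/-! ## §4 The tame case `p ∤ [K₀ : K]`: the hypotheses of (A2) hold (Kobayashi's `K₀ = ℚ(μ_p)`) -/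

omit [(galRange (K := K) K₀).Normal] in
/-- **`κ` is onto on `Gal(K̄/K₀)` whenever `K₀/K` is Galois of degree prime to `p`**: for
`x ∈ ℤ_p` pick `g` with `κ g = d⁻¹·x` (`d = [K₀ : K]`, a unit of `ℤ_p`); then `g^d ∈ Gal(K̄/K₀)`
(`RelModel.pow_finrank_mem_galRange`: `Γ_K / Gal(K̄/K₀)` has order `d`) and `κ(g^d) = x`. So
`K₀ ∩ K_∞^κ = K`. Kobayashi: `K = ℚ`, `K₀ = ℚ(μ_p)`, `d = p − 1` ("`G_∞ = Δ × Γ`, `Δ ≅ ℤ/(p−1)ℤ`,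
`Γ ≅ ℤ_p`", p. 5); additive-p1: `K₀ = ℚ(√p*)`, `d = 2`, `p` odd.
[cite: Kobayashi2003, §3 p. 5 (G_∞ = Δ × Γ)] -/
theorem kappa_surjOn_galRange_of_coprime_finrank [IsGalois K K₀]
    (hcop : Nat.Coprime p (Module.finrank K K₀)) (x : Multiplicative ℤ_[p]) :
    ∃ g ∈ galRange (K := K) K₀, κ g = x := by
  have hnd : ¬p ∣ Module.finrank K K₀ := (Nat.Prime.coprime_iff_not_dvd (Fact.out : p.Prime)).mp hcop
  obtain ⟨u, hu⟩ := IwasawaDual.isUnit_natCast_padicInt (p := p) hnd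
  obtain ⟨g, hg⟩ := κ.surjective (Multiplicative.ofAdd (((u⁻¹ : ℤ_[p]ˣ) : ℤ_[p]) * x.toAdd))
  have hg' : κ g = Multiplicative.ofAdd (((u⁻¹ : ℤ_[p]ˣ) : ℤ_[p]) * x.toAdd) := hg
  refine ⟨g ^ Module.finrank K K₀, RelModel.pow_finrank_mem_galRange (K := K) K₀ g, ?_⟩
  rw [map_pow, hg', ← ofAdd_nsmul, nsmul_eq_mul, ← hu, ← mul_assoc, Units.mul_inv, one_mul,
    ofAdd_toAdd]

omit [(galRange (K := K) K₀).Normal] in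
/-- In the tame case there IS a topological generator inside `Gal(K̄/K₀)`: some `γ ∈ Gal(K̄/K₀)` has
`κ γ = 1` — Kobayashi's "we fix a topological generator `γ ∈ Γ`", `Γ = Gal(K₀K_∞/K₀)`.
[cite: Kobayashi2003, §3 p. 5] -/
theorem exists_isTopGenerator_mem_galRange [IsGalois K K₀]
    (hcop : Nat.Coprime p (Module.finrank K K₀)) :
    ∃ γ ∈ galRange (K := K) K₀, κ.IsTopGenerator γ :=
  kappa_surjOn_galRange_of_coprime_finrank κ K₀ hcop (Multiplicative.ofAdd 1)

/-- **Existence in the tame case, hypothesis-free up to the choice of `γ`**: for `K₀/K` Galois of degree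
prime to `p` and `γ ∈ Gal(K̄/K₀)` with `κ γ = 1` (which exists, `exists_isTopGenerator_mem_galRange`),
`EtaSignedSelmerDualData W κ K₀ E η γ ε` is inhabited. For `K = ℚ`, `κ` cyclotomic, `K₀ = ℚ(μ_p)`,
`E = ℚ_[p]`, `ε = −1`, `η` the character of `ℚ(√p*)`: Kobayashi's `X⁻(E/K_∞)^η` as a
`ℤ_p[[Γ]]`-module, `γ ↔ 1 + X`. [cite: Kobayashi2003, Def. 2.1 (p. 5), §3 p. 5, §4 p. 8]
[cite: GreenbergLNM1716, §1 (p. 60)] -/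
theorem nonempty_etaSignedSelmerDualData_of_coprime_finrank [IsGalois K K₀]
    (hcop : Nat.Coprime p (Module.finrank K K₀)) {γ : Field.absoluteGaloisGroup K}
    (hγ : κ.IsTopGenerator γ) (hγ₀ : γ ∈ galRange (K := K) K₀) :
    Nonempty (EtaSignedSelmerDualData W κ K₀ E η γ ε) :=
  nonempty_etaSignedSelmerDualData W κ K₀ E η ε
    (kappa_surjOn_galRange_of_coprime_finrank κ K₀ hcop) hγ hγ₀

/-! ## §5 Kobayashi's setting verbatim: `K = ℚ`, `K₀ = ℚ(μ_p)` -/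

section Cyclotomic

variable {p : ℕ} [Fact p.Prime] (W : WeierstrassCurve ℚ) (κ : ZpExtension ℚ p)
  (K₀ : Type) [Field K₀] [NumberField K₀] [Algebra ℚ K₀] [IsCyclotomicExtension {p} ℚ K₀]
  (E : Type) [Field E] [Algebra ℚ E] (η : Field.absoluteGaloisGroup ℚ →* ℤˣ) (ε : ℤˣ)

/-- **For `K₀ = ℚ(μ_p)` and ANY `ℤ_p`-extension `κ` of `ℚ`, `κ` is onto on `Gal(ℚ̄/ℚ(μ_p))`**:
`[ℚ(μ_p) : ℚ] = φ(p) = p − 1` (`IsCyclotomicExtension.finrank`, `Φ_p` irreducible over `ℚ`) is prime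
to `p` — "`G_∞ = Δ × Γ`, `Δ ≅ ℤ/(p−1)ℤ`, `Γ ≅ ℤ_p`" (p. 5). [cite: Kobayashi2003, §3 p. 5] -/
theorem kappa_surjOn_galRange_cyclotomic (x : Multiplicative ℤ_[p]) :
    ∃ g ∈ galRange (K := ℚ) K₀, κ g = x := by
  haveI := IsCyclotomicExtension.isGalois {p} ℚ K₀
  have hp : p.Prime := Fact.out
  refine kappa_surjOn_galRange_of_coprime_finrank κ K₀ ?_ x
  rw [IsCyclotomicExtension.finrank K₀ (Polynomial.cyclotomic.irreducible_rat hp.pos),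
    Nat.totient_prime hp]
  exact (Nat.Prime.coprime_iff_not_dvd hp).mpr
    (Nat.not_dvd_of_pos_of_lt (Nat.sub_pos_of_lt hp.one_lt) (Nat.sub_lt hp.pos Nat.one_pos))

/-- **Kobayashi's `X^ε(E/K_∞)^η` as a `ℤ_p[[Γ]]`-module EXISTS in the tree's sense** for `K = ℚ`,
`K₀ = ℚ(μ_p)`, any `κ`, `E`, `ε`, quadratic `η`, and any topological generator `γ ∈ Gal(ℚ̄/ℚ(μ_p))`
(normality of `Gal(ℚ̄/ℚ(μ_p))` = `RelModel.normal_galRange`, the caller's instance). Object only;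
Thm. 2.2 NOT asserted. [cite: Kobayashi2003, Def. 2.1 (p. 5), Thm. 2.2 (the object only), §4 p. 8] -/
theorem nonempty_etaSignedSelmerDualData_cyclotomic [(galRange (K := ℚ) K₀).Normal]
    {γ : Field.absoluteGaloisGroup ℚ} (hγ : κ.IsTopGenerator γ) (hγ₀ : γ ∈ galRange (K := ℚ) K₀) :
    Nonempty (EtaSignedSelmerDualData W κ K₀ E η γ ε) :=
  nonempty_etaSignedSelmerDualData W κ K₀ E η ε (kappa_surjOn_galRange_cyclotomic κ K₀) hγ hγ₀

end Cyclotomic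

end Summit.BirchSwinnertonDyer.Rank1Residual.Additive

end
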